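import Literature.AlgebraicGeometry.Resolution.Hauser2010
import Mathlib.Algebra.MvPolynomial.Division
import Mathlib.FieldTheory.IsAlgClosed.AlgebraicClosure
import Mathlib.Algebra.Field.ZMod
import Mathlib.Algebra.CharP.Algebra
import HarnessLib

/-!
# Barrier: the residual order is not eventually bounded — Hauser–Perlega's cycles (Moh's Stability Theorem fails for `e ≥ 3`)

`Literature/Barriers/ResolutionOfSingularities/ResidualOrderUnbounded.lean` — barrier catalogue
entry (D-0021) for the summit `ResolutionOfSingularities`. Companion of
`KangarooShadeIncrease.lean` (ONE blow-up can raise the residual order / shade by at most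
`p^{e−1}`, Moh 1987): here the printed result that along a SEQUENCE of permissible point
blow-ups the residual order of a purely inseparable hypersurface singularity
`z^{pᵉ} + F(x) = 0` can tend to infinity (Hauser–Perlega 2019), refuting the Stability Theorem
claimed by Moh (1987) for `e ≥ 3`. The explicit one-blow-up computation printed by
Hauser–Perlega to locate the flaw in Moh's proof is PROVED below; the main theorem (whose two
families of examples run over `ℕ`-parametrised exponents and multi-stage blow-up sequences)
is vendored as a NAMED FACT in the authors' §2 setting, transcribed into Lean definitions.

## What the sources print (verified on the page: arXiv:1802.05010 = J. Algebraic Geom. 28 (2019))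

* Hauser–Perlega, §1, verbatim: "In positive characteristic, this approach meets serious
  obstructions: First, hypersurfaces of maximal contact need no longer exist. A substitute are
  regular hypersurfaces maximizing the order of the ideals `K` and `I` … They permit the
  definition of `ord_a I` as an intrinsic and significant second component of `inv_a X`, the
  residual order of `X` at `a`. The next obstruction then is the fact that in positive
  characteristic the residual order may increase under blowup at points where `ord_a X` has
  remained constant. However, the increase is not too large, happens very rarely, and can
  explictly be bounded, as Moh showed [Moh87, Hau10, HP16]. This raised the hope that the
  invariant `inv_a X` may drop in the long run and thus serves again to establish resolution.
  This has been proven to work for surfaces [HW14, HP17] and is still open in higher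
  dimensions. For arbitrary dimensions, Moh claimed in [Moh87] that the invariant cannot
  increase under permissible blowup beyond a certain bound. It turns out that this claim is
  false. In fact, we prove in the present note: *There exists a purely inseparable
  hypersurface singularity `X` and a sequence of permissible blowups along which the order of
  `X` remains constant but for which the orders of the residual ideals `I` tend to infinity.*
  … The centers are always points". Also §1: "We were not able to construct examples with
  cycles where the choice of point centers is forced (e.g., because the singularities are
  isolated). Of course, such an example would disprove the existence of resolution of
  singularities in positive characteristic." [cite: HauserPerlega2019, §1]
* Hauser–Perlega, §2 "Setting", verbatim: `K` algebraically closed of characteristic `p > 0`;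
  "purely inseparable equations of the form `f(z,x) = z^{pᵉ} + F(x₁,…,xₙ) = 0`, where `e` is a
  positive integer and `F ∈ K[[x₁,…,xₙ]]` is a power series of order `ord F ≥ pᵉ`"; "a change
  of parameters `z₁ = z − g` … changes the expansion of `f` to `f = z₁^{pᵉ} + g^{pᵉ} + F`.
  Hence, any `pᵉ`-th power that appears in the expansion of `F` can be eliminated via such a
  change. … We then say that `F` is *clean* if no `pᵉ`-th powers appear in its expansion.
  Respectively, we refer to a change of parameters `z₁ = z − g` which eliminates all `pᵉ`-th
  powers from `F` as *cleaning*"; `E = V(∏_{i∈Δ} xᵢ)`; "Write `F` in the form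
  `F = ∏_{i∈Δ} xᵢ^{rᵢ} · G` where … `rᵢ = ord_{(xᵢ)} F` denotes the order of `F` along the
  component `xᵢ = 0`. We call the order of this power series `G` the *residual order* of `f`
  with respect to the normal crossings divisor `E`, `residual.order_E f = ord G`"; permissible
  centres `P = (z, xᵢ : i ∈ Γ)` with (1) `f ∈ P^{pᵉ}`, (2) `G ∈ P^d`; "The maximal ideal
  `(z,x₁,…,xₙ)` always defines a permissible center"; "`ord f' ≤ ord f = pᵉ` always holds. …
  we only consider the case where equality holds. There then exists an index `j ∈ Γ` and
  constants `tᵢ ∈ K` such that the map `π` is of the form `π(z) = x_j z`, `π(x_j) = x_j`,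
  `π(xᵢ) = x_j(xᵢ + tᵢ)` for `i ∈ Γ ∖ {j}`, `π(x_l) = x_l` for `l ∉ Γ`. If `P` is the maximal
  ideal, we will refer to `π` as a *point blowup*"; "The strict transform of `f` under `π` has
  the form `f' = z^{pᵉ} + F'(x₁,…,xₙ)` where `F' = x_j^{−pᵉ} π(F)`. … After applying cleaning,
  we obtain a new expansion `f' = z^{pᵉ} + F'_clean` from which we can compute the residual
  order of `f'` with respect to the normal crossings divisor `E' = V(x_j · ∏_{i∈Δ∖B} xᵢ)`
  obtained as the total transform of `E`, where the set `B` is defined as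
  `B = {j} ∪ {i : tᵢ ≠ 0}`." [cite: HauserPerlega2019, §2]
* Hauser–Perlega, §3, verbatim: "Moh was able to show in [Moh87] that the increase under a
  *single blowup* is bounded by `p^{e−1}`. … Moh claimed in [Moh87] that the following
  *Stability Theorem* holds: *Let be given a purely inseparable equation
  `f = z^{pᵉ} + F(x₁,…,xₙ) = 0` with residual order `d` and a sequence of permissible blowups
  under which the order of the strict transforms of `f` remain constant. Then the residual
  orders of the strict transforms of `f` cannot increase beyond the bound `d + p^{e−1}`.* …
  Below we will present examples of purely inseparable equations with `e = 3` and infinite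
  sequences of point blowups under which the residual order tends to infinity. This disproves
  Moh's claim in the case `e ≥ 3` (it is known to be valid for `e = 1`). Although the examples
  might seem discouraging for proving resolution of singularities in positive characteristic,
  we emphasize that they do not constitute a counterexample to the existence of resolutions in
  positive characteristic. The reason for this is that in the examples one could choose at
  various instances a larger center than a point …. The flaw in Moh's proof of the Stability
  Theorem is relatively subtle. On p. 970 in [Moh87], a non-negative integer `r` is defined as
  the maximal number with the property that the initial form of `F` is a `pʳ`-th power. It is
  then claimed that one may assume without loss of generality that the residual order `d` is
  divisible by `pʳ`. This leads to the false conclusion that, after blowup, the residual order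
  is bounded by `d' ≤ [d/pʳ]·pʳ + pʳ`. As the following example shows, this is not true.
  Consider the purely inseparable polynomial `f = z⁴ + x²y²w³(w(x+y)⁴ + x¹³)` over a field of
  characteristic `2`. The residual order of `f` is `d = 5`. Further, `pʳ = 2`. Let `f'` be the
  strict transform of `f` under a point blowup in the `x`-chart with translation `y ↦ y + 1`.
  Then `f' = z⁴ + x⁸w³(wy⁴ + wy⁶ + x⁸ + x⁸y²) = z₁⁴ + x⁸w³(wy⁶ + x⁸ + x⁸y²)` after cleaning.
  Hence, the residual order of `f'` is `d' = 7`. This exceeds the bound `[d/pʳ]·pʳ + pʳ = 6`."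
  §4: "First example: Field of characteristic `p = 2`, `n = 5`, `ord f = 8`. … All blowups are
  point blowups. … Since the sequence of blowups can be iterated indefinitely, the residual
  order also increases indefinitely." "Second example: Field of characteristic `p ≥ 3`, `n = 4`,
  `ord f = p³`." [cite: HauserPerlega2019, §3 and §4]
* Moh (1987), Stability Theorem as quoted in `KangarooShadeIncrease.lean`: one permissible
  blow-up raises `ord F̄` by at most `p^{e−1}`. [cite: Moh1987, Stability Theorem]

## Lean rendering

Polynomial case of the §2 setting (HP allow `F ∈ K[[x]]`; their examples and the §3
computation are polynomial, and point blow-ups and cleaning preserve polynomials), in the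
sub-namespace `HauserPerlega`: `IsClean q F` (no monomial of `F` has all exponents divisible
by `q = pᵉ` — over a perfect field exactly "no `pᵉ`-th powers appear"; cleaning is then
`Hauser2010.deletePthPowers q`), `ordAlong i F = ord_{(xᵢ)} F`, `exceptionalExp Δ F = r`,
`residualFactor Δ F = G = F / x^r` (Mathlib's `divMonomial`), `residualOrder Δ F = ord G`
(`Hauser2010.ordZero`), the point blow-up `pointBlowupSubst j t` / `totalTransform` /
`transformResidual q j t F = x_j^{−q} π(F)`, the new exceptional set
`newExceptional Δ j t = {j} ∪ {i ∈ Δ : i ≠ j, tᵢ = 0}`, and `IsPointBlowupSequence`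
(HP's iterated "point blowup + cleaning, order of `f` constant"). PROVED (variables
`0 ↦ x, 1 ↦ y, 2 ↦ w`): the §3 computation end to end — `hpF0 = x²y²w³(w(x+y)⁴ + x¹³)` is
clean with exceptional monomial `x²y²w³`, residual factor `x⁴w + y⁴w + x¹³` and residual order
`5`, its initial form is the square `(x³yw² + xy³w²)²`; under the point blow-up (`x`-chart,
`y ↦ y + 1`) `π(F⁰) = x⁴ · F¹raw`, `F¹raw = x⁸w³(wy⁴ + wy⁶ + x⁸ + x⁸y²)`, cleaning deletes
`(x²yw)⁴` and gives `hpF1 = x⁸w³(wy⁶ + x⁸ + x⁸y²)`, clean, of order `18 ≥ 4`, new exceptional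
set `{x, w}`, exceptional monomial `x⁸w³`, residual order `7`; and `7 > [5/2]·2 + 2 = 6`
while `7 ≤ 5 + 2^{2−1}` (`hauserPerlega_mohProofBoundFails`). NAMED FACTS: `HauserPerlega2019`
(main theorem, rendered for point blow-ups with the printed scope of the two example families:
`p = 2, e = 3, n = 5` and `p` odd, `e = 3`, `n = 4`; residual order TENDS TO INFINITY,
`TendsToInfinity`) and, for the record, the refuted `MohStabilityClaim`, with
`not_mohStabilityClaim : HauserPerlega2019 → ¬ MohStabilityClaim` proved.
-/

noncomputable section

open MvPolynomial Finset

open scoped BigOperators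

namespace Literature.Barriers.ResolutionOfSingularities

open Literature.AlgebraicGeometry.Resolution.Hauser2010

namespace HauserPerlega

/-! ## The setting of Hauser–Perlega §2 (polynomial case) -/

section Setting

variable {σ : Type*} {K : Type*} [CommRing K]

/-- `F` is **clean** (for `q = pᵉ`): no monomial of `F` is a `q`-th power monomial, i.e. none
has all its exponents divisible by `q` ("We then say that `F` is clean if no `pᵉ`-th powers
appear in its expansion"; over the algebraically closed `K` of the source a monomial `c·x^d` is a
`pᵉ`-th power iff `pᵉ ∣ dᵢ` for all `i`). [cite: HauserPerlega2019, §2] -/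
def IsClean (q : ℕ) (F : MvPolynomial σ K) : Prop :=
  ∀ d ∈ F.support, ¬ IsPthPowerExponent q d

/-- `ord_{(xᵢ)} F`, "the order of `F` along the component `xᵢ = 0`": the least exponent of `xᵢ`
in a monomial of `F` (`⊤` for `F = 0`). [cite: HauserPerlega2019, §2] -/
def ordAlong (i : σ) (F : MvPolynomial σ K) : ℕ∞ :=
  F.support.inf fun d => ((d i : ℕ) : ℕ∞)

/-- `ordAlong i F = n` iff some monomial of `F` has `xᵢ`-exponent `n` and none has less. [folklore] -/
theorem ordAlong_eq_natCast_iff (i : σ) (F : MvPolynomial σ K) (n : ℕ) :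
    ordAlong i F = n ↔ (∃ d, coeff d F ≠ 0 ∧ d i = n) ∧ ∀ d, coeff d F ≠ 0 → n ≤ d i := by
  unfold ordAlong
  constructor
  · intro h
    have hne : F.support.Nonempty := by
      by_contra h0
      rw [Finset.not_nonempty_iff_eq_empty] at h0
      rw [h0, Finset.inf_empty] at h
      exact ENat.top_ne_coe n h
    obtain ⟨d, hd, hdeq⟩ := Finset.exists_mem_eq_inf F.support hne (fun d => ((d i : ℕ) : ℕ∞))
    refine ⟨⟨d, MvPolynomial.mem_support_iff.mp hd, ?_⟩, fun e he => ?_⟩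
    · exact_mod_cast (hdeq.symm.trans h)
    · have := Finset.inf_le (f := fun d => ((d i : ℕ) : ℕ∞)) (MvPolynomial.mem_support_iff.mpr he)
      rw [h] at this
      exact_mod_cast this
  · rintro ⟨⟨d, hd, hdeq⟩, hmin⟩
    apply le_antisymm
    · have := Finset.inf_le (f := fun d => ((d i : ℕ) : ℕ∞)) (MvPolynomial.mem_support_iff.mpr hd)
      simpa [hdeq] using this
    · refine Finset.le_inf fun e he => ?_
      exact_mod_cast hmin e (MvPolynomial.mem_support_iff.mp he)

/-- The exceptional monomial exponent `r = (rᵢ)_{i∈Δ}`, `rᵢ = ord_{(xᵢ)} F` (`0` off `Δ`), of the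
factorisation `F = ∏_{i∈Δ} xᵢ^{rᵢ} · G`. [cite: HauserPerlega2019, §2] -/
def exceptionalExp (Δ : Finset σ) (F : MvPolynomial σ K) : σ →₀ ℕ :=
  ∑ i ∈ Δ, (ordAlong i F).toNat • Finsupp.single i 1

/-- The residual factor `G = F / ∏_{i∈Δ} xᵢ^{rᵢ}` (exact division by the exceptional monomial,
Mathlib's `divMonomial`). [cite: HauserPerlega2019, §2] -/
def residualFactor (Δ : Finset σ) (F : MvPolynomial σ K) : MvPolynomial σ K :=
  MvPolynomial.divMonomial F (exceptionalExp Δ F)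

/-- **Residual order** of `f = z^{pᵉ} + F` (with `F` clean) with respect to `E = V(∏_{i∈Δ} xᵢ)`:
`residual.order_E f = ord G`. [cite: HauserPerlega2019, §2] -/
def residualOrder (Δ : Finset σ) (F : MvPolynomial σ K) : ℕ∞ :=
  ordZero (residualFactor Δ F)

variable [DecidableEq σ]

/-- The **point blow-up** in the `x_j`-chart with translations `t` (`t_j` is not used):
`π(x_j) = x_j`, `π(xᵢ) = x_j (xᵢ + tᵢ)` for `i ≠ j` (on `z`: `π(z) = x_j z`).
[cite: HauserPerlega2019, §2] -/
def pointBlowupSubst (j : σ) (t : σ → K) : σ → MvPolynomial σ K :=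
  fun i => if i = j then X j else X j * (X i + C (t i))

/-- The total transform `π(F)` under the point blow-up. [cite: HauserPerlega2019, §2] -/
def totalTransform (j : σ) (t : σ → K) (F : MvPolynomial σ K) : MvPolynomial σ K :=
  aeval (pointBlowupSubst j t) F

/-- `F' = x_j^{−q} π(F)`, the `F`-part of the strict transform `f' = z^q + F'` of `f = z^q + F`
(`q = pᵉ`; the division is exact when `ord F ≥ q`). [cite: HauserPerlega2019, §2] -/
def transformResidual (q : ℕ) (j : σ) (t : σ → K) (F : MvPolynomial σ K) : MvPolynomial σ K :=
  MvPolynomial.divMonomial (totalTransform j t F) (Finsupp.single j q)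

/-- The new exceptional set: `E' = V(x_j · ∏_{i ∈ Δ ∖ B} xᵢ)` with `B = {j} ∪ {i : tᵢ ≠ 0}`, i.e.
`Δ' = {j} ∪ {i ∈ Δ : i ≠ j, tᵢ = 0}`. [cite: HauserPerlega2019, §2] -/
def newExceptional (Δ : Finset σ) (j : σ) (t : σ → K) : Finset σ := by
  classical
  exact insert j (Δ.filter fun i => i ≠ j ∧ t i = 0)

/-- A **sequence of point blow-ups along which the order of `f` remains constant**, in the §2
setting: at stage `k` the clean `F k` (with `ord (F k) ≥ q`, i.e. `ord f = q = pᵉ`) is blown up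
at the point centre in the `x_{j k}`-chart with translations `t k`, and `F (k+1)` is the cleaned
`F`-part `(x_j^{−q} π(F k))_clean` of the strict transform, with exceptional set updated by the
printed rule. [cite: HauserPerlega2019, §2] -/
structure IsPointBlowupSequence (q : ℕ) (F : ℕ → MvPolynomial σ K) (Δ : ℕ → Finset σ)
    (j : ℕ → σ) (t : ℕ → σ → K) : Prop where
  clean : ∀ k, IsClean q (F k)
  ord_le : ∀ k, (q : ℕ∞) ≤ ordZero (F k)
  transform : ∀ k, F (k + 1) = deletePthPowers q (transformResidual q (j k) (t k) (F k))
  exceptional : ∀ k, Δ (k + 1) = newExceptional (Δ k) (j k) (t k)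

end Setting

/-! ## Named facts: the main theorem and the refuted Stability claim -/

/-- A sequence in `ℕ∞` **tends to infinity**: it eventually exceeds every natural number
("the residual order tends to infinity", "increases indefinitely"). [cite: HauserPerlega2019, §3 and §4] -/
def TendsToInfinity (a : ℕ → ℕ∞) : Prop :=
  ∀ N : ℕ, ∃ k₀ : ℕ, ∀ k, k₀ ≤ k → (N : ℕ∞) < a k

/-- Over the field `K`: **there is a point blow-up sequence of clean polynomials in `n` variables
with `ord ≥ pᵉ` (order of `f = z^{pᵉ} + F` constant `= pᵉ`) whose residual order starts at a
natural number `d` and tends to infinity.** [cite: HauserPerlega2019, §1 (main statement) and §4] -/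
def HasDivergentPointBlowupSequence (p e n : ℕ) (K : Type) [Field K] : Prop :=
  ∃ (F : ℕ → MvPolynomial (Fin n) K) (Δ : ℕ → Finset (Fin n)) (j : ℕ → Fin n)
    (t : ℕ → Fin n → K),
    IsPointBlowupSequence (p ^ e) F Δ j t ∧
    (∃ d : ℕ, residualOrder (Δ 0) (F 0) = d) ∧
    TendsToInfinity fun k => residualOrder (Δ k) (F k)

/-- NAMED FACT — **Hauser–Perlega 2019, main theorem with its printed scope** ("There exists a
purely inseparable hypersurface singularity `X` and a sequence of permissible blowups along
which the order of `X` remains constant but for which the orders of the residual ideals `I`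
tend to infinity"; proved over the standing algebraically closed field `K` of characteristic
`p > 0` of §2 by two families of examples with point centres only and `e = 3`: "First example:
Field of characteristic `p = 2`, `n = 5`, `ord f = 8`" and "Second example: Field of
characteristic `p ≥ 3`, `n = 4`, `ord f = p³`", "All blowups are point blowups", "Since the
sequence of blowups can be iterated indefinitely, the residual order also increases
indefinitely"). Rendered in the polynomial §2 setting for point blow-ups: for every
algebraically closed field `K` of characteristic `2` there is a divergent point blow-up
sequence with `pᵉ = 2³`, `n = 5`; for every odd prime `p` and every algebraically closed `K`
of characteristic `p`, one with `pᵉ = p³`, `n = 4`. Users take `(h : HauserPerlega2019)`.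
[cite: HauserPerlega2019, §1 (main statement), §3, §4 (Examples 1 and 2)] -/
def HauserPerlega2019 : Prop :=
  (∀ (K : Type) [Field K] [IsAlgClosed K] [CharP K 2], HasDivergentPointBlowupSequence 2 3 5 K) ∧
  (∀ (p : ℕ) (K : Type) [Field K] [IsAlgClosed K] [CharP K p], p.Prime → p ≠ 2 →
    HasDivergentPointBlowupSequence p 3 4 K)

/-- NAMED STATEMENT (REFUTED, kept for the record) — **Moh's Stability Theorem as quoted by
Hauser–Perlega** ("Let be given a purely inseparable equation `f = z^{pᵉ} + F = 0` with residual
order `d` and a sequence of permissible blowups under which the order of the strict transforms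
of `f` remain constant. Then the residual orders of the strict transforms of `f` cannot increase
beyond the bound `d + p^{e−1}`"), restricted to point blow-up sequences in the §2 setting over
algebraically closed fields. Hauser–Perlega: "This disproves Moh's claim in the case `e ≥ 3`
(it is known to be valid for `e = 1`)" — see `not_mohStabilityClaim`. Do NOT take
`(h : MohStabilityClaim)` as a hypothesis. [cite: HauserPerlega2019, §3] [cite: Moh1987, Stability Theorem] -/
def MohStabilityClaim : Prop :=
  ∀ (p e n : ℕ) (K : Type) [Field K] [IsAlgClosed K] [CharP K p], p.Prime → 1 ≤ e →
    ∀ (F : ℕ → MvPolynomial (Fin n) K) (Δ : ℕ → Finset (Fin n)) (j : ℕ → Fin n)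
      (t : ℕ → Fin n → K), IsPointBlowupSequence (p ^ e) F Δ j t →
      ∀ k, residualOrder (Δ k) (F k) ≤ residualOrder (Δ 0) (F 0) + (p ^ (e - 1) : ℕ)

/-- Hauser–Perlega's theorem refutes the Stability claim: over an algebraic closure of `𝔽₂` the
Example-1 sequence eventually exceeds `d + 2^{3−1}`. [cite: HauserPerlega2019, §3] -/
theorem not_mohStabilityClaim (h : HauserPerlega2019) : ¬ MohStabilityClaim := by
  intro hM
  haveI : Fact (Nat.Prime 2) := ⟨Nat.prime_two⟩
  let K := AlgebraicClosure (ZMod 2)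
  haveI : CharP K 2 :=
    charP_of_injective_algebraMap (algebraMap (ZMod 2) K).injective 2
  obtain ⟨F, Δ, j, t, hseq, ⟨d, hd⟩, hinf⟩ := h.1 K
  obtain ⟨k₀, hk₀⟩ := hinf (d + 2 ^ (3 - 1))
  have hk := hk₀ k₀ le_rfl
  have hle := hM 2 3 5 K Nat.prime_two (by norm_num) F Δ j t hseq k₀
  rw [hd] at hle
  have : ((d + 2 ^ (3 - 1) : ℕ) : ℕ∞) < (d : ℕ∞) + ((2 ^ (3 - 1) : ℕ) : ℕ∞) :=
    lt_of_lt_of_le hk hle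
  exact lt_irrefl _ (by exact_mod_cast this)

/-! ## Exponent vectors and monomials in the three variables `x, y, w` -/

section Exp3

/-- The exponent `(a, b, c)` of `xᵃyᵇwᶜ` (variables `0 ↦ x, 1 ↦ y, 2 ↦ w`). [folklore] -/
def exp3 (a b c : ℕ) : Fin 3 →₀ ℕ :=
  Finsupp.single 0 a + Finsupp.single 1 b + Finsupp.single 2 c

/-- `x`-exponent. [folklore] -/
@[simp] theorem exp3_apply_zero (a b c : ℕ) : exp3 a b c 0 = a := by simp [exp3]
/-- `y`-exponent. [folklore] -/
@[simp] theorem exp3_apply_one (a b c : ℕ) : exp3 a b c 1 = b := by simp [exp3]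
/-- `w`-exponent. [folklore] -/
@[simp] theorem exp3_apply_two (a b c : ℕ) : exp3 a b c 2 = c := by simp [exp3]

/-- Equality of exponent vectors is componentwise. [folklore] -/
theorem exp3_eq_iff (a b c a' b' c' : ℕ) :
    exp3 a b c = exp3 a' b' c' ↔ a = a' ∧ b = b' ∧ c = c' := by
  constructor
  · intro h
    exact ⟨by simpa using DFunLike.congr_fun h 0, by simpa using DFunLike.congr_fun h 1,
      by simpa using DFunLike.congr_fun h 2⟩
  · rintro ⟨rfl, rfl, rfl⟩; rfl

/-- Total degree of `xᵃyᵇwᶜ`. [folklore] -/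
@[simp] theorem exp3_degree (a b c : ℕ) : (exp3 a b c).degree = a + b + c := by
  simp [exp3, map_add]

/-- Product of monomials. [folklore] -/
theorem exp3_add (a b c a' b' c' : ℕ) :
    exp3 a b c + exp3 a' b' c' = exp3 (a + a') (b + b') (c + c') := by
  ext i; fin_cases i <;> simp

/-- `xᵃyᵇwᶜ` is a `q`-th power monomial iff `q` divides `a`, `b` and `c`. [folklore] -/
theorem isPthPowerExponent_exp3_iff (q a b c : ℕ) :
    IsPthPowerExponent q (exp3 a b c) ↔ q ∣ a ∧ q ∣ b ∧ q ∣ c := by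
  rw [isPthPowerExponent_iff]
  constructor
  · intro h; exact ⟨by simpa using h 0, by simpa using h 1, by simpa using h 2⟩
  · rintro ⟨ha, hb, hc⟩ i
    fin_cases i <;> simpa

variable (K : Type*) [CommRing K]

/-- The monomial `xᵃyᵇwᶜ` with coefficient `1`. [folklore] -/
def mono (a b c : ℕ) : MvPolynomial (Fin 3) K := monomial (exp3 a b c) 1

/-- `mono a b c = xᵃ yᵇ wᶜ`. [folklore] -/
theorem mono_eq (a b c : ℕ) : mono K a b c = X 0 ^ a * X 1 ^ b * X 2 ^ c := by
  rw [X_pow_eq_monomial, X_pow_eq_monomial, X_pow_eq_monomial, monomial_mul, monomial_mul]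
  simp [mono, exp3]

variable {K} in
/-- Coefficients of `mono`. [folklore] -/
theorem coeff_mono (a b c : ℕ) (d : Fin 3 →₀ ℕ) :
    coeff d (mono K a b c) = if exp3 a b c = d then 1 else 0 := by
  simp [mono, coeff_monomial]

end Exp3

/-! ## The computation of Hauser–Perlega §3: the data -/

section Data

variable (K : Type*) [CommRing K]

/-- `F⁰ = x⁶y²w⁴ + x²y⁶w⁴ + x¹⁵y²w³`, the expansion of `x²y²w³(w(x+y)⁴ + x¹³)` in characteristic
`2` (`hpF0_eq`); `f = z⁴ + F⁰`, `p = 2`, `pᵉ = 4`. [cite: HauserPerlega2019, §3] -/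
def hpF0 : MvPolynomial (Fin 3) K := mono K 6 2 4 + mono K 2 6 4 + mono K 15 2 3

/-- `G⁰ = x⁴w + y⁴w + x¹³ = w(x+y)⁴ + x¹³`, the residual factor of `F⁰` w.r.t. `E = V(xyw)`.
[cite: HauserPerlega2019, §3] -/
def hpG0 : MvPolynomial (Fin 3) K := mono K 4 0 1 + mono K 0 4 1 + mono K 13 0 0

/-- The translation vector of the blow-up "`x`-chart, `y ↦ y + 1`": `t = (0, 1, 0)`.
[cite: HauserPerlega2019, §3] -/
def hpShift : Fin 3 → K := fun i => if i = 1 then 1 else 0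

/-- `F¹raw = x⁸y⁶w⁴ + x⁸y⁴w⁴ + x¹⁶y²w³ + x¹⁶w³ = x⁸w³(wy⁴ + wy⁶ + x⁸ + x⁸y²)`, the `F`-part of the
strict transform before cleaning. [cite: HauserPerlega2019, §3] -/
def hpF1raw : MvPolynomial (Fin 3) K := mono K 8 6 4 + mono K 8 4 4 + mono K 16 2 3 + mono K 16 0 3

/-- `F¹ = x⁸y⁶w⁴ + x¹⁶y²w³ + x¹⁶w³ = x⁸w³(wy⁶ + x⁸y² + x⁸)`, after cleaning (`z₁ = z + x²yw`).
[cite: HauserPerlega2019, §3] -/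
def hpF1 : MvPolynomial (Fin 3) K := mono K 8 6 4 + mono K 16 2 3 + mono K 16 0 3

/-- `G¹ = wy⁶ + x⁸y² + x⁸`, the residual factor of `F¹` w.r.t. `E' = V(xw)`. [cite: HauserPerlega2019, §3] -/
def hpG1 : MvPolynomial (Fin 3) K := mono K 0 6 1 + mono K 8 2 0 + mono K 8 0 0

/-- `F⁰` is the printed `x²y²w³(w(x+y)⁴ + x¹³)` in characteristic `2`. [cite: HauserPerlega2019, §3] -/
theorem hpF0_eq [CharP K 2] :
    hpF0 K = X 0 ^ 2 * X 1 ^ 2 * X 2 ^ 3 * (X 2 * (X 0 + X 1) ^ 4 + X 0 ^ 13) := by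
  have : CharP (MvPolynomial (Fin 3) K) 2 := inferInstance
  simp only [hpF0, mono_eq]
  ring_nf
  reduce_mod_char!

/-- `F⁰ = x²y²w³ · G⁰`. [cite: HauserPerlega2019, §3] -/
theorem hpF0_factor : hpF0 K = monomial (exp3 2 2 3) 1 * hpG0 K := by
  simp only [hpF0, hpG0, mono, mul_add, monomial_mul, one_mul, exp3_add]

/-- `F¹raw` is the printed `x⁸w³(wy⁴ + wy⁶ + x⁸ + x⁸y²)`. [cite: HauserPerlega2019, §3] -/
theorem hpF1raw_eq :
    hpF1raw K = X 0 ^ 8 * X 2 ^ 3 * (X 2 * X 1 ^ 4 + X 2 * X 1 ^ 6 + X 0 ^ 8 + X 0 ^ 8 * X 1 ^ 2) := by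
  simp only [hpF1raw, mono_eq]; ring

/-- `F¹` is the printed `x⁸w³(wy⁶ + x⁸ + x⁸y²)`. [cite: HauserPerlega2019, §3] -/
theorem hpF1_eq : hpF1 K = X 0 ^ 8 * X 2 ^ 3 * (X 2 * X 1 ^ 6 + X 0 ^ 8 + X 0 ^ 8 * X 1 ^ 2) := by
  simp only [hpF1, mono_eq]; ring

/-- `F¹ = x⁸w³ · G¹`. [cite: HauserPerlega2019, §3] -/
theorem hpF1_factor : hpF1 K = monomial (exp3 8 0 3) 1 * hpG1 K := by
  simp only [hpF1, hpG1, mono, mul_add, monomial_mul, one_mul, exp3_add]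

/-- Coefficients of `F⁰`. [folklore] -/
theorem coeff_hpF0 (d : Fin 3 →₀ ℕ) : coeff d (hpF0 K) =
    (if exp3 6 2 4 = d then 1 else 0) + (if exp3 2 6 4 = d then 1 else 0) +
      (if exp3 15 2 3 = d then 1 else 0) := by
  simp only [hpF0, coeff_add, coeff_mono]

/-- Coefficients of `G⁰`. [folklore] -/
theorem coeff_hpG0 (d : Fin 3 →₀ ℕ) : coeff d (hpG0 K) =
    (if exp3 4 0 1 = d then 1 else 0) + (if exp3 0 4 1 = d then 1 else 0) +
      (if exp3 13 0 0 = d then 1 else 0) := by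
  simp only [hpG0, coeff_add, coeff_mono]

/-- Coefficients of `F¹`. [folklore] -/
theorem coeff_hpF1 (d : Fin 3 →₀ ℕ) : coeff d (hpF1 K) =
    (if exp3 8 6 4 = d then 1 else 0) + (if exp3 16 2 3 = d then 1 else 0) +
      (if exp3 16 0 3 = d then 1 else 0) := by
  simp only [hpF1, coeff_add, coeff_mono]

/-- Coefficients of `G¹`. [folklore] -/
theorem coeff_hpG1 (d : Fin 3 →₀ ℕ) : coeff d (hpG1 K) =
    (if exp3 0 6 1 = d then 1 else 0) + (if exp3 8 2 0 = d then 1 else 0) +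
      (if exp3 8 0 0 = d then 1 else 0) := by
  simp only [hpG1, coeff_add, coeff_mono]

/-! ### The blow-up "`x`-chart, `y ↦ y + 1`" and the cleaning -/

/-- **Total transform**: `π(F⁰) = F⁰(x, x(y+1), xw) = x⁴ · F¹raw` in characteristic `2`.
[cite: HauserPerlega2019, §3] -/
theorem totalTransform_hpF0 [CharP K 2] :
    totalTransform 0 (hpShift K) (hpF0 K) = monomial (Finsupp.single 0 4) 1 * hpF1raw K := by
  have : CharP (MvPolynomial (Fin 3) K) 2 := inferInstance
  rw [hpF1raw_eq, ← X_pow_eq_monomial]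
  simp only [totalTransform, hpF0, mono_eq, pointBlowupSubst, hpShift, map_add, map_mul, map_pow,
    aeval_X]
  simp only [Fin.isValue, Fin.reduceEq, ↓reduceIte, one_ne_zero, map_one, map_zero, add_zero]
  ring_nf
  reduce_mod_char!

/-- **Strict transform**: `F' = x⁻⁴ π(F⁰) = F¹raw`, i.e. `f' = z⁴ + x⁸w³(wy⁴ + wy⁶ + x⁸ + x⁸y²)`.
[cite: HauserPerlega2019, §3] -/
theorem transformResidual_hpF0 [CharP K 2] :
    transformResidual 4 0 (hpShift K) (hpF0 K) = hpF1raw K := by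
  rw [transformResidual, totalTransform_hpF0, divMonomial_monomial_mul]

/-- **Cleaning** deletes exactly the `4`-th power monomial `x⁸y⁴w⁴ = (x²yw)⁴`:
`(F¹raw)_clean = F¹`. [cite: HauserPerlega2019, §3] -/
theorem deletePthPowers_hpF1raw : deletePthPowers 4 (hpF1raw K) = hpF1 K := by
  simp only [hpF1raw, hpF1, mono, deletePthPowers_add, deletePthPowers_monomial,
    isPthPowerExponent_exp3_iff]
  norm_num

/-- The cleaning is the coordinate change `z₁ = z + x²yw`: `F¹raw = F¹ + (x²yw)⁴`, so
`z⁴ + F¹raw = z₁⁴ + F¹` in characteristic `2`. [cite: HauserPerlega2019, §3 ("= z₁⁴ + … after cleaning")] -/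
theorem hpF1raw_eq_add_pow : hpF1raw K = hpF1 K + (X 0 ^ 2 * X 1 * X 2) ^ 4 := by
  simp only [hpF1raw, hpF1, mono_eq]; ring

/-- `F¹` is the cleaned `F`-part of the strict transform of `F⁰`. [cite: HauserPerlega2019, §3] -/
theorem hpF1_eq_transform [CharP K 2] :
    hpF1 K = deletePthPowers 4 (transformResidual 4 0 (hpShift K) (hpF0 K)) := by
  rw [transformResidual_hpF0, deletePthPowers_hpF1raw]

/-- `F⁰` is clean (no `4`-th power monomials). [cite: HauserPerlega2019, §3] -/
theorem isClean_hpF0 : IsClean 4 (hpF0 K) := by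
  intro d hd
  rw [MvPolynomial.mem_support_iff, coeff_hpF0] at hd
  by_cases h1 : exp3 6 2 4 = d
  · subst h1; rw [isPthPowerExponent_exp3_iff]; decide
  by_cases h2 : exp3 2 6 4 = d
  · subst h2; rw [isPthPowerExponent_exp3_iff]; decide
  by_cases h3 : exp3 15 2 3 = d
  · subst h3; rw [isPthPowerExponent_exp3_iff]; decide
  simp [h1, h2, h3] at hd

/-- `F¹` is clean. [cite: HauserPerlega2019, §3] -/
theorem isClean_hpF1 : IsClean 4 (hpF1 K) := by
  intro d hd
  rw [MvPolynomial.mem_support_iff, coeff_hpF1] at hd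
  by_cases h1 : exp3 8 6 4 = d
  · subst h1; rw [isPthPowerExponent_exp3_iff]; decide
  by_cases h2 : exp3 16 2 3 = d
  · subst h2; rw [isPthPowerExponent_exp3_iff]; decide
  by_cases h3 : exp3 16 0 3 = d
  · subst h3; rw [isPthPowerExponent_exp3_iff]; decide
  simp [h1, h2, h3] at hd

/-- "Further, `pʳ = 2`": the initial form of `F⁰` (degree `12`) is the square
`(x³yw² + xy³w²)²` in characteristic `2` (and, `F⁰` being clean, not a `4`-th power monomial sum).
[cite: HauserPerlega2019, §3] -/
theorem homogeneousComponent_hpF0 [CharP K 2] :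
    homogeneousComponent 12 (hpF0 K) = (X 0 ^ 3 * X 1 * X 2 ^ 2 + X 0 * X 1 ^ 3 * X 2 ^ 2) ^ 2 := by
  have : CharP (MvPolynomial (Fin 3) K) 2 := inferInstance
  have h : (X 0 ^ 3 * X 1 * X 2 ^ 2 + X 0 * X 1 ^ 3 * X 2 ^ 2 : MvPolynomial (Fin 3) K) ^ 2 =
      mono K 6 2 4 + mono K 2 6 4 := by
    simp only [mono_eq]; ring_nf; reduce_mod_char!
  rw [h]
  ext d
  rw [coeff_homogeneousComponent, coeff_add, coeff_mono, coeff_mono, coeff_hpF0]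
  by_cases h1 : exp3 6 2 4 = d
  · subst h1; simp [exp3_eq_iff]
  by_cases h2 : exp3 2 6 4 = d
  · subst h2; simp [exp3_eq_iff]
  by_cases h3 : exp3 15 2 3 = d
  · subst h3; simp [exp3_eq_iff]
  simp [h1, h2, h3]

end Data

/-! ## The computation of Hauser–Perlega §3: orders -/

section Orders

variable (K : Type*) [CommRing K] [Nontrivial K]

/-- `ord F⁰ = 12 ≥ 4`: `f = z⁴ + F⁰` has order `4 = pᵉ`, so the point centre is permissible.
[cite: HauserPerlega2019, §2 and §3] -/
theorem ordZero_hpF0 : ordZero (hpF0 K) = 12 := by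
  rw [show (12 : ℕ∞) = ((12 : ℕ) : ℕ∞) from rfl, ordZero_eq_nat_iff]
  refine ⟨⟨exp3 6 2 4, ?_, by simp⟩, fun d hd => ?_⟩
  · simp [coeff_hpF0, exp3_eq_iff]
  · have h1 : exp3 6 2 4 ≠ d := by rintro rfl; simp at hd
    have h2 : exp3 2 6 4 ≠ d := by rintro rfl; simp at hd
    have h3 : exp3 15 2 3 ≠ d := by rintro rfl; simp at hd
    simp [coeff_hpF0, h1, h2, h3]

/-- `ord F¹ = 18 ≥ 4`: the order of `f' = z₁⁴ + F¹` is still `4` (equiconstant point).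
[cite: HauserPerlega2019, §2 and §3] -/
theorem ordZero_hpF1 : ordZero (hpF1 K) = 18 := by
  rw [show (18 : ℕ∞) = ((18 : ℕ) : ℕ∞) from rfl, ordZero_eq_nat_iff]
  refine ⟨⟨exp3 8 6 4, ?_, by simp⟩, fun d hd => ?_⟩
  · simp [coeff_hpF1, exp3_eq_iff]
  · have h1 : exp3 8 6 4 ≠ d := by rintro rfl; simp at hd
    have h2 : exp3 16 2 3 ≠ d := by rintro rfl; simp at hd
    have h3 : exp3 16 0 3 ≠ d := by rintro rfl; simp at hd
    simp [coeff_hpF1, h1, h2, h3]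

/-- `ord_{(x)} F⁰ = 2`. [cite: HauserPerlega2019, §3] -/
theorem ordAlong_zero_hpF0 : ordAlong 0 (hpF0 K) = 2 := by
  rw [show (2 : ℕ∞) = ((2 : ℕ) : ℕ∞) from rfl, ordAlong_eq_natCast_iff]
  refine ⟨⟨exp3 2 6 4, ?_, by simp⟩, fun d hd => ?_⟩
  · simp [coeff_hpF0, exp3_eq_iff]
  · rw [coeff_hpF0] at hd
    by_contra hlt
    have h1 : exp3 6 2 4 ≠ d := by rintro rfl; simp at hlt
    have h2 : exp3 2 6 4 ≠ d := by rintro rfl; simp at hlt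
    have h3 : exp3 15 2 3 ≠ d := by rintro rfl; simp at hlt
    simp [h1, h2, h3] at hd

/-- `ord_{(y)} F⁰ = 2`. [cite: HauserPerlega2019, §3] -/
theorem ordAlong_one_hpF0 : ordAlong 1 (hpF0 K) = 2 := by
  rw [show (2 : ℕ∞) = ((2 : ℕ) : ℕ∞) from rfl, ordAlong_eq_natCast_iff]
  refine ⟨⟨exp3 6 2 4, ?_, by simp⟩, fun d hd => ?_⟩
  · simp [coeff_hpF0, exp3_eq_iff]
  · rw [coeff_hpF0] at hd
    by_contra hlt
    have h1 : exp3 6 2 4 ≠ d := by rintro rfl; simp at hlt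
    have h2 : exp3 2 6 4 ≠ d := by rintro rfl; simp at hlt
    have h3 : exp3 15 2 3 ≠ d := by rintro rfl; simp at hlt
    simp [h1, h2, h3] at hd

/-- `ord_{(w)} F⁰ = 3`. [cite: HauserPerlega2019, §3] -/
theorem ordAlong_two_hpF0 : ordAlong 2 (hpF0 K) = 3 := by
  rw [show (3 : ℕ∞) = ((3 : ℕ) : ℕ∞) from rfl, ordAlong_eq_natCast_iff]
  refine ⟨⟨exp3 15 2 3, ?_, by simp⟩, fun d hd => ?_⟩
  · simp [coeff_hpF0, exp3_eq_iff]
  · rw [coeff_hpF0] at hd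
    by_contra hlt
    have h1 : exp3 6 2 4 ≠ d := by rintro rfl; simp at hlt
    have h2 : exp3 2 6 4 ≠ d := by rintro rfl; simp at hlt
    have h3 : exp3 15 2 3 ≠ d := by rintro rfl; simp at hlt
    simp [h1, h2, h3] at hd

/-- The exceptional monomial of `F⁰` w.r.t. `E = V(xyw)` is `x²y²w³`. [cite: HauserPerlega2019, §3] -/
theorem exceptionalExp_hpF0 : exceptionalExp Finset.univ (hpF0 K) = exp3 2 2 3 := by
  rw [exceptionalExp, Fin.sum_univ_three, ordAlong_zero_hpF0, ordAlong_one_hpF0, ordAlong_two_hpF0]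
  ext i; fin_cases i <;> simp [exp3]

/-- The residual factor of `F⁰` is `G⁰ = w(x+y)⁴ + x¹³`. [cite: HauserPerlega2019, §3] -/
theorem residualFactor_hpF0 : residualFactor Finset.univ (hpF0 K) = hpG0 K := by
  rw [residualFactor, exceptionalExp_hpF0, hpF0_factor, divMonomial_monomial_mul]

/-- `ord G⁰ = 5`. [cite: HauserPerlega2019, §3] -/
theorem ordZero_hpG0 : ordZero (hpG0 K) = 5 := by
  rw [show (5 : ℕ∞) = ((5 : ℕ) : ℕ∞) from rfl, ordZero_eq_nat_iff]
  refine ⟨⟨exp3 4 0 1, ?_, by simp⟩, fun d hd => ?_⟩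
  · simp [coeff_hpG0, exp3_eq_iff]
  · have h1 : exp3 4 0 1 ≠ d := by rintro rfl; simp at hd
    have h2 : exp3 0 4 1 ≠ d := by rintro rfl; simp at hd
    have h3 : exp3 13 0 0 ≠ d := by rintro rfl; simp at hd
    simp [coeff_hpG0, h1, h2, h3]

/-- **"The residual order of `f` is `d = 5`"** (w.r.t. `E = V(xyw)`). [cite: HauserPerlega2019, §3] -/
theorem residualOrder_hpF0 : residualOrder Finset.univ (hpF0 K) = 5 := by
  rw [residualOrder, residualFactor_hpF0, ordZero_hpG0]

/-- The new exceptional set after "`x`-chart, `y ↦ y + 1`" is `{x, w}` (`B = {x, y}`).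
[cite: HauserPerlega2019, §2 (the set B) and §3] -/
theorem newExceptional_hp : newExceptional Finset.univ 0 (hpShift K) = {0, 2} := by
  ext i
  fin_cases i <;> simp [newExceptional, hpShift]

/-- `ord_{(x)} F¹ = 8`. [cite: HauserPerlega2019, §3] -/
theorem ordAlong_zero_hpF1 : ordAlong 0 (hpF1 K) = 8 := by
  rw [show (8 : ℕ∞) = ((8 : ℕ) : ℕ∞) from rfl, ordAlong_eq_natCast_iff]
  refine ⟨⟨exp3 8 6 4, ?_, by simp⟩, fun d hd => ?_⟩
  · simp [coeff_hpF1, exp3_eq_iff]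
  · rw [coeff_hpF1] at hd
    by_contra hlt
    have h1 : exp3 8 6 4 ≠ d := by rintro rfl; simp at hlt
    have h2 : exp3 16 2 3 ≠ d := by rintro rfl; simp at hlt
    have h3 : exp3 16 0 3 ≠ d := by rintro rfl; simp at hlt
    simp [h1, h2, h3] at hd

/-- `ord_{(w)} F¹ = 3`. [cite: HauserPerlega2019, §3] -/
theorem ordAlong_two_hpF1 : ordAlong 2 (hpF1 K) = 3 := by
  rw [show (3 : ℕ∞) = ((3 : ℕ) : ℕ∞) from rfl, ordAlong_eq_natCast_iff]
  refine ⟨⟨exp3 16 2 3, ?_, by simp⟩, fun d hd => ?_⟩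
  · simp [coeff_hpF1, exp3_eq_iff]
  · rw [coeff_hpF1] at hd
    by_contra hlt
    have h1 : exp3 8 6 4 ≠ d := by rintro rfl; simp at hlt
    have h2 : exp3 16 2 3 ≠ d := by rintro rfl; simp at hlt
    have h3 : exp3 16 0 3 ≠ d := by rintro rfl; simp at hlt
    simp [h1, h2, h3] at hd

/-- The exceptional monomial of `F¹` w.r.t. `E' = V(xw)` is `x⁸w³`. [cite: HauserPerlega2019, §3] -/
theorem exceptionalExp_hpF1 : exceptionalExp {0, 2} (hpF1 K) = exp3 8 0 3 := by
  rw [exceptionalExp, Finset.sum_pair (by decide), ordAlong_zero_hpF1, ordAlong_two_hpF1]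
  ext i; fin_cases i <;> simp [exp3]

/-- The residual factor of `F¹` is `G¹ = wy⁶ + x⁸ + x⁸y²`. [cite: HauserPerlega2019, §3] -/
theorem residualFactor_hpF1 : residualFactor {0, 2} (hpF1 K) = hpG1 K := by
  rw [residualFactor, exceptionalExp_hpF1, hpF1_factor, divMonomial_monomial_mul]

/-- `ord G¹ = 7`. [cite: HauserPerlega2019, §3] -/
theorem ordZero_hpG1 : ordZero (hpG1 K) = 7 := by
  rw [show (7 : ℕ∞) = ((7 : ℕ) : ℕ∞) from rfl, ordZero_eq_nat_iff]
  refine ⟨⟨exp3 0 6 1, ?_, by simp⟩, fun d hd => ?_⟩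
  · simp [coeff_hpG1, exp3_eq_iff]
  · have h1 : exp3 0 6 1 ≠ d := by rintro rfl; simp at hd
    have h2 : exp3 8 2 0 ≠ d := by rintro rfl; simp at hd
    have h3 : exp3 8 0 0 ≠ d := by rintro rfl; simp at hd
    simp [coeff_hpG1, h1, h2, h3]

/-- **"Hence, the residual order of `f'` is `d' = 7`"** (w.r.t. `E' = V(xw)`). [cite: HauserPerlega2019, §3] -/
theorem residualOrder_hpF1 : residualOrder {0, 2} (hpF1 K) = 7 := by
  rw [residualOrder, residualFactor_hpF1, ordZero_hpG1]

end Orders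

/-! ## The barrier: headline and docstring block (D-0021) -/

/-- **BARRIER (D-0021 block).**

- technique_class: residual-order resolution-invariant moh-stability-theorem eventual-bound-on-residual-order bounded-increase-of-invariant order-of-coefficient-ideal cleaning purely-inseparable-equation point-blowup-sequence induction-on-invariant long-run-decrease-of-invariant shade
- blocks: (technique in words: resolution invariants whose second component is the RESIDUAL ORDER — the order of the cleaned residual factor `G` of `F` modulo the exceptional monomial, for purely inseparable equations `z^{pᵉ} + F(x) = 0`, "a generalization of a resolution invariant that is successfully used over fields of characteristic zero" — used lexicographically under `ord f` and expected to be eventually bounded / to drop "in the long run" along permissible blow-ups with `ord f` constant: Moh's Stability Theorem programme; Lean: `MohStabilityClaim`, `IsPointBlowupSequence`, `residualOrder` [cite: HauserPerlega2019, §1–§3] [cite: Moh1987, Stability Theorem]) — (i) Moh's claimed Stability Theorem (bound `d + p^{e−1}` along a whole sequence of permissible blow-ups with `ord f` constant) for `e ≥ 3`: false (`HauserPerlega2019`, `not_mohStabilityClaim`) [cite: HauserPerlega2019, §3]; (ii) the intermediate bound `d' ≤ [d/pʳ]·pʳ + pʳ` of Moh's proof (p. 970 of [Moh87]): false already after ONE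 point blow-up (PROVED here, `hauserPerlega_mohProofBoundFails`) [cite: HauserPerlega2019, §3]; (iii) hence, for the printed hypersurfaces `z⁸ + F(x, y, u, v, w) = 0` in `𝔸⁶` (characteristic `2`, `n = 5`) and `z^{p³} + F(x, y, v, w) = 0` in `𝔸⁵` (characteristic `p ≥ 3`, `n = 4`), any termination argument resting on an eventual bound for the residual order under point blow-ups: "this result would rule out the possibility of the residual order increasing indefinitely" — but it does increase indefinitely [cite: HauserPerlega2019, §3 and §4]; "For arbitrary dimensions, Moh claimed in [Moh87] that the invariant cannot increase under permissible blowup beyond a certain bound. It turns out that this claim is false" [cite: HauserPerlega2019, §1].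
- because: along carefully chosen sequences of point blow-ups the defining equation returns to its initial shape with exponents and residual order shifted upwards — a cycle — so "the residual order also increases indefinitely" (Example 1: `p = 2, n = 5, ord f = 8`, `d` raised to `d + 2` per cycle; Example 2: `p ≥ 3, n = 4, ord f = p³`, `d` raised to `d + (p−1)p/2` per cycle); the flaw in Moh's proof is the reduction to `pʳ ∣ d`, refuted by `f = z⁴ + x²y²w³(w(x+y)⁴ + x¹³)`, `d = 5 ↦ d' = 7 > 6` [cite: HauserPerlega2019, §3 and §4].
- evasions_known: (a) surfaces: the residual-order invariant does work in dimension two — "This has been proven to work for surfaces [HW14, HP17]" [cite: HauserPerlega2019, §1]; (b) larger centres: "in the examples one could choose at various instances a larger center than a point and thus would end up with a different sequence of blowups for which the residual order need not tend to infinity"; no example is known "where the choice of point centers is forced" [cite: HauserPerlega2019, §1 and §3]; (c) `e = 1`: Moh's stability bound "is known to be valid for `e = 1`" [cite: HauserPerlega2019, §3]; (d) a single blow-up raises the residual order by at most `p^{e−1}` (Moh) [cite: Moh1987, Stability Theorem] [cite: HauserPerlega2019, §3].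
- scope_caveats: (a) "they do not constitute a counterexample to the existence of resolutions in positive characteristic" [cite: HauserPerlega2019, §3]; (b) only POINT blow-ups occur in the printed examples, and the Lean named fact `HauserPerlega2019` / the refuted `MohStabilityClaim` are rendered for point blow-up sequences in the polynomial case of the §2 setting (the source allows power series `F` and general permissible centres `(z, xᵢ : i ∈ Γ)`); (c) what is PROVED here is the one-blow-up computation of §3 (`d = 5 ↦ d' = 7`), which violates the proof-internal bound `6` but NOT Moh's (correct) single-blow-up bound `d + p^{e−1} = 7`; the cycles themselves (multi-stage blow-up sequences with `ℕ`-parametrised exponents) are vendored as a named fact with the printed parameters (`e = 3`; `p = 2, n = 5`; `p` odd, `n = 4`), not re-verified in THIS file — (update 2026-08-16) both cycles are now kernel-checked downstream: `HauserPerlega2019_holds` (`ResidualOrderUnboundedHolds.lean`, on `…Example1Cycle.lean` / `…Example2Cycle.lean`, over EVERY field of the respective characteristic) and the unconditional `mohStabilityClaim_false` (`ResidualOrderUnboundedProofs.lean`); (d) NOT covered: `e ≤ 2`, and ambient dimensions below the printed ones (hypersurfaces of dimension `≤ 4` in characteristic `2`, `≤ 3` in odd characteristic) — for surfaces the programme works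 and the source only says it "is still open in higher dimensions" [cite: HauserPerlega2019, §1]; (e) `IsClean` is phrased by exponents (`pᵉ ∣` all exponents), which is the printed notion over the algebraically closed ground field of the source; (f) (barrier audit 2026-08-16, see `ResidualOrderUnboundedNarrow.lean`, `ResidualOrderUnboundedNarrow`) of the technique_class words only claims UNIFORM OVER THE CHOICE OF PERMISSIBLE CENTRES are covered — an eventual bound / long-run decrease of the uncorrected residual order along EVERY permissible (in particular every point) blow-up sequence with `ord f` constant, i.e. Moh's programme as printed [cite: Moh1987, pp. 966–967]; this for EVERY `e ≥ 3` and every `n ≥ 5` (`p = 2`) / `n ≥ 4` (`p` odd) (Frobenius twist `F ↦ F(xᵖ)` and idle variables, proved there); NOT covered: `resolution-invariant`, `induction-on-invariant`, `shade`, `order-of-coefficient-ideal`, `cleaning`, `point-blowup-sequence` as a whole — strategies whose centre is prescribed by the singularity are untouched (at the starting equation of the first example the `3`-dimensional centres `(z, x, w)`, `(z, u, w)` are permissible in the sense of §2, proved there; the divergent run CHOOSES the point), the ONE-blow-up bound `d' ≤ d + p^{e−1}` is true [cite: Moh1987, p. 966] [cite: HauserPerlega2019PRIMS, §1 (Theorem)],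 `e ≤ 2` and fewer variables are open, not refuted. (status detail: established — Hauser–Perlega 2019, J. Algebraic Geom. 28; the refutation of [Moh87]'s Stability Theorem for `e ≥ 3` is asserted there, kernel-checked here, and not disputed in print.)
- status: established, scope narrowed 2026-08-16 — see `ResidualOrderUnboundedNarrow.lean`

**Headline (PROVED).** For every nontrivial commutative ring `K` of characteristic `2`:
`F⁰ = x²y²w³(w(x+y)⁴ + x¹³)` is clean of order `12 ≥ 4` with residual order `d = 5` w.r.t.
`E = V(xyw)`; its cleaned point-blow-up transform (`x`-chart, `y ↦ y+1`) is
`F¹ = x⁸w³(wy⁶ + x⁸ + x⁸y²)`, clean of order `18 ≥ 4`, with exceptional set `{x, w}` and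
residual order `d' = 7`; and `7 > [5/2]·2 + 2 = 6` while `7 ≤ 5 + 2^{2−1}`.
[cite: HauserPerlega2019, §3] -/
theorem hauserPerlega_mohProofBoundFails (K : Type*) [CommRing K] [Nontrivial K] [CharP K 2] :
    IsClean 4 (hpF0 K) ∧ (4 : ℕ∞) ≤ ordZero (hpF0 K) ∧
    residualOrder Finset.univ (hpF0 K) = 5 ∧
    hpF1 K = deletePthPowers 4 (transformResidual 4 0 (hpShift K) (hpF0 K)) ∧
    newExceptional Finset.univ 0 (hpShift K) = {0, 2} ∧
    IsClean 4 (hpF1 K) ∧ (4 : ℕ∞) ≤ ordZero (hpF1 K) ∧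
    residualOrder {0, 2} (hpF1 K) = 7 ∧
    (5 / 2) * 2 + 2 < 7 ∧ 7 ≤ 5 + 2 ^ (2 - 1) := by
  refine ⟨isClean_hpF0 K, ?_, residualOrder_hpF0 K, hpF1_eq_transform K, newExceptional_hp K,
    isClean_hpF1 K, ?_, residualOrder_hpF1 K, by norm_num, by norm_num⟩
  · rw [ordZero_hpF0]; decide
  · rw [ordZero_hpF1]; decide

/-- The increase `5 < 7` of the residual order at constant order `4` of `f`, as an inequality of
the two residual orders computed above. [cite: HauserPerlega2019, §3] -/
theorem residualOrder_hpF0_lt_hpF1 (K : Type*) [CommRing K] [Nontrivial K] :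
    residualOrder Finset.univ (hpF0 K) < residualOrder {0, 2} (hpF1 K) := by
  rw [residualOrder_hpF0, residualOrder_hpF1]; decide

end HauserPerlega

end Literature.Barriers.ResolutionOfSingularities
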